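import Summits.CriticalPhenomena.CardyFormulaZ2.Theorems.CardyFlipRussoCoveringLegReductions
import Literature.Probability.RandomPlanarGeometry.ConformalRectangleProofs
import HarnessLib

/-!
# `CardyFlipRusso.CoveringLeg` and frame-free site/bond crossing universality (line `five-arm-null`, lead c2)

Route `CardyFlipRusso`, sub-problem `CriticalPhenomena/CardyFormulaZ2`, crux item stmt-CriticalPhenomena-6435
(`Summit.CriticalPhenomena.CardyFormulaZ2.Theses.CardyFlipRusso.CoveringLeg` = `SiteCardy → BondCardy`: Cardy's
formula for critical SITE percolation on the centred square lattice `G_s` (crude discretisation, standard embedding)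
IMPLIES Cardy's formula for critical BOND percolation on `ℤ²` (crude discretisation `embDomainCrossing`)).

Skeleton v3 of the line is closed modulo ONE registered stub, Beffara's open eq. (5.1) (`stub_pivotalBalanceShift`);
the landed reductions (`…CoveringLegReductions.lean`, p122660) show that the composition consumes only the frame-free
crossing-universality statement `∀ R, siteProb (ρ⁻¹R) δ − bondProb R δ → 0` (`coveringLeg_of_crossingUniversality`).
This file makes that statement PORTABLE and CALIBRATES it:

* `siteProb_map_rotInv_eq` — rotating the rectangle by `ρ⁻¹ = (1+i)/√2` is the same as rotating the LATTICE by
  `ρ = (1−i)/√2` (rigid transport, exact): `siteProb (ρ⁻¹R) δ` is the crude crossing probability of `R` itself for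
  site percolation at `½` on `G_s` embedded by `ρ · z` (`z` the crux's own embedding);
* `coveringLeg_of_siteBondCrossingUniversality` — **the crux follows from SITE/BOND CROSSING UNIVERSALITY written
  SELF-CONTAINED in Literature vocabulary** (the hypothesis is a `let`-expanded statement a planner can file verbatim
  as an item: for every conformal rectangle `R`, the crude crossing probability of `R` for critical site percolation
  on the `45°`-rotated centred square lattice of site-spacing `δ` and the crude crossing probability of `R` for
  critical bond percolation on `ℤ²` of edge-length `√2·δ` (the tree's `squareLatticeEmbedding.z` at mesh `δ`; these
  are exactly Kesten's covering scales) differ by `o(1)` as `δ → 0⁺`);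
* `siteBondCrossingUniversality_of_cardy` — conversely that statement FOLLOWS from the two Cardy formulas
  (`SiteCardy`, `BondCardy`), unconditionally (uniformizing data exist: `MarkedDomain.exists_isUniformizing_holds`;
  a rotation carries them along with the same real boundary preimages); hence
* `coveringLeg_iff_universality_of_siteCardy` — **under the crux's own hypothesis `SiteCardy` (= `Target.2` of the
  route), `CoveringLeg` is EQUIVALENT to site/bond crossing universality.**  The crux therefore carries exactly the
  content "site-`G_s` and bond-`ℤ²` cross conformal rectangles alike", no more and no less; every bookkeeping and
  boundary layer between the two lattices is a theorem of the tree.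

No new definitions; nothing is asserted unconditionally about percolation.

References: V. Beffara, *Is critical 2D percolation universal?*, Progr. Probab. 60 (2008) §5.1–5.2 [Beffara2008Universal];
H. Kesten, *Percolation theory for mathematicians* (1982) §3.4 [Kesten1982]; R. Langlands, P. Pouliot, Y. Saint-Aubin,
Bull. AMS 30 (1994) §2 (crossing universality hypothesis) [LanglandsPouliotSaintaubin1994].
-/

noncomputable section

namespace Summit.CriticalPhenomena.CardyFormulaZ2.Cruxes.CoveringLeg.FiveArmNull

open Filter Set Topology
open Literature.Probability.RandomPlanarGeometry Literature.Probability.Percolation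
open Literature.Probability.LatticeModels
open Literature.Barriers.CriticalPhenomena (MixedSite mixedParam)
open Summit.CriticalPhenomena.CardyFormulaZ2.Theses

/-! ### Rotating the rectangle by `ρ⁻¹` = rotating the lattice by `ρ` -/

/-- At mesh `δ`, the rotation `p ↦ ρ⁻¹ p` carries the position `δ ρ z y` of every vertex of the `ρ`-rotated lattice
onto its standard position `δ z y` (`ρ⁻¹ ρ = 1`). [folklore] -/
theorem frame_rotInv_mul_rot_mul (δ : ℝ) (y : MixedSite) :
    (1 + Complex.I) / (Real.sqrt 2 : ℂ) *
          ((δ : ℂ) * ((1 - Complex.I) / (Real.sqrt 2 : ℂ) * centredSquareEmbedding y)) + 0 =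
      (δ : ℂ) * centredSquareEmbedding y := by
  rw [add_zero, mul_left_comm, ← mul_assoc ((1 + Complex.I) / (Real.sqrt 2 : ℂ)), frame_rotInv_mul_rot, one_mul]

/-- **Rigid transport (exact).** The crude site-`G_s` crossing probability `siteProb (ρ⁻¹R) δ` of the `+45°`-rotated
rectangle (standard embedding `z` of `G_s`) IS the crude crossing probability of `R` itself for `G_s` embedded by the
`−45°`-rotated embedding `ρ · z`, `ρ = (1 − i)/√2`, at the same mesh. [cite: Beffara2008Universal, §5.1] -/
theorem siteProb_map_rotInv_eq (R : ConformalRectangle) (δ : ℝ) :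
    siteProb (R.map (similarity ((1 + Complex.I) / (Real.sqrt 2 : ℂ)) frame_rotInv_ne_zero 0)) δ =
      (sitePercolation MixedSite half).real
        (siteEmbDomainCrossing gS (fun y => (1 - Complex.I) / (Real.sqrt 2 : ℂ) * centredSquareEmbedding y)
          R.carrier δ (R.arc 0) (R.arc 2)) := by
  rw [siteProb_eq, frame_siteEmbDomainCrossing_eq_map gS frame_norm_rotInv frame_rotInv_ne_zero 0
    (z := centredSquareEmbedding) (z' := fun y => (1 - Complex.I) / (Real.sqrt 2 : ℂ) * centredSquareEmbedding y)
    (frame_rotInv_mul_rot_mul δ) R 0 2]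

/-! ### The crux from self-contained site/bond crossing universality -/

/-- **`CoveringLeg` ⟸ SITE/BOND CROSSING UNIVERSALITY (self-contained form; CONDITIONAL proof of the crux by name).**
Hypothesis, in Literature vocabulary only (`z`, `G` are the crux's own `let`s; `zρ = ρ·z` is the `−45°`-rotated
embedding): for every conformal rectangle `R`, the crude crossing probability of `R` for site percolation at `½` on
the rotated centred square lattice (site spacing `δ`) minus the crude crossing probability of `R` for bond percolation
at `½` on `ℤ²` (`squareLatticeEmbedding.z`, edge length `√2 δ` — Kesten's covering scale) tends to `0` as `δ → 0⁺`.
Conclusion: the crux.  Proof: rigid transport (`siteProb_map_rotInv_eq`) + `coveringLeg_of_crossingUniversality`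
(skeleton v3 with its three landed stubs and the tree's crude-crossing continuity for bond-`ℤ²`).
[cite: Beffara2008Universal, §5.1–5.2] -/
theorem coveringLeg_of_siteBondCrossingUniversality :
    (let z : (ℤ × ℤ) ⊕ (ℤ × ℤ) → ℂ := Sum.elim (fun x ↦ (x.1 : ℂ) + (x.2 : ℂ) * Complex.I)
          (fun f ↦ ((f.1 : ℂ) + 1 / 2) + ((f.2 : ℂ) + 1 / 2) * Complex.I);
      let G : SimpleGraph ((ℤ × ℤ) ⊕ (ℤ × ℤ)) := SimpleGraph.fromRel (fun a b ↦ a.isLeft = true ∧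
          ((b.isLeft = true ∧ dist (z a) (z b) = 1) ∨ (b.isRight = true ∧ dist (z a) (z b) < 1)));
      let zρ : (ℤ × ℤ) ⊕ (ℤ × ℤ) → ℂ := fun y ↦ (1 - Complex.I) / (Real.sqrt 2 : ℂ) * z y;
      ∀ R : Literature.Probability.RandomPlanarGeometry.ConformalRectangle, Filter.Tendsto (fun δ : ℝ ↦
          (Literature.Probability.Percolation.sitePercolation ((ℤ × ℤ) ⊕ (ℤ × ℤ))
              Literature.Probability.Percolation.half).real
            {ω | ∃ u v, Metric.infDist ((δ : ℂ) * zρ u) (R.arc 0) ≤ 2 * δ ∧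
              Metric.infDist ((δ : ℂ) * zρ v) (R.arc 2) ≤ 2 * δ ∧
              ω ∈ Literature.Probability.Percolation.siteConnIn G {y | (δ : ℂ) * zρ y ∈ R.carrier} u v} -
          (Literature.Probability.Percolation.bondPercolation (Literature.Probability.LatticeModels.zdGraph 2)
              Literature.Probability.Percolation.half).real
            (Literature.Probability.Percolation.embDomainCrossing
              Literature.Probability.LatticeModels.squareLatticeEmbedding.z R.carrier δ (R.arc 0) (R.arc 2)))
          (nhdsWithin 0 (Set.Ioi 0)) (nhds 0)) →
    Summit.CriticalPhenomena.CardyFormulaZ2.Theses.CardyFlipRusso.CoveringLeg := by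
  intro hU
  refine coveringLeg_of_crossingUniversality fun R => ?_
  simp only [siteProb_map_rotInv_eq]
  exact hU R

/-! ### Calibration: universality is implied by the two Cardy formulas, so under `SiteCardy` the crux IS universality -/

/-- **Site/bond crossing universality ⟸ the two Cardy formulas** (unconditional): if both the crude site-`G_s` and the
crude bond-`ℤ²` crossing probabilities obey Cardy's formula for every conformal rectangle, then for every `R` the
site probability of `ρ⁻¹R` and the bond probability of `R` have the same limit `F(η_R)` — a rotation carries any
uniformizing datum `(φ, x)` of `R` to one of `ρ⁻¹R` with the same real boundary preimages
(`frame_exists_isUniformizing_map_similarity`), and uniformizing data exist (`MarkedDomain.exists_isUniformizing_holds`,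
Riemann mapping + Carathéodory, proved in tree). [cite: Beffara2008Universal, §1.2] -/
theorem siteBondCrossingUniversality_of_cardy (hS : SiteCardy) (hB : BondCardy) :
    ∀ R : ConformalRectangle, Tendsto (fun δ : ℝ =>
      siteProb (R.map (similarity ((1 + Complex.I) / (Real.sqrt 2 : ℂ)) frame_rotInv_ne_zero 0)) δ -
        bondProb R δ) (𝓝[>] 0) (𝓝 0) := by
  intro R
  obtain ⟨φ, x, hφ⟩ := MarkedDomain.exists_isUniformizing_holds (n := 4) R
  obtain ⟨ψ, hψ⟩ := frame_exists_isUniformizing_map_similarity R _ frame_rotInv_ne_zero 0 hφ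
  have h := (hS _ ψ x hψ).sub (hB R φ x hφ)
  rwa [sub_self] at h

/-- **Under the crux hypothesis, `CoveringLeg` ⟺ site/bond crossing universality.**  Given `SiteCardy` (the second
conjunct of the route's `Target`), the crux `CoveringLeg` holds iff for every conformal rectangle the crude site-`G_s`
crossing probability of `ρ⁻¹R` and the crude bond-`ℤ²` crossing probability of `R` differ by `o(1)`: "→" is
`siteBondCrossingUniversality_of_cardy`, "←" is `coveringLeg_of_crossingUniversality` (the line's landed skeleton).
[cite: Beffara2008Universal, §5.1–5.2] -/
theorem coveringLeg_iff_universality_of_siteCardy : SiteCardy →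
    (CardyFlipRusso.CoveringLeg ↔
      ∀ R : ConformalRectangle, Tendsto (fun δ : ℝ =>
        siteProb (R.map (similarity ((1 + Complex.I) / (Real.sqrt 2 : ℂ)) frame_rotInv_ne_zero 0)) δ -
          bondProb R δ) (𝓝[>] 0) (𝓝 0)) :=
  fun hS => ⟨fun h => siteBondCrossingUniversality_of_cardy hS (coveringLeg_iff.1 h hS),
    coveringLeg_of_crossingUniversality⟩

/-! ### Universality makes the two Cardy formulas equivalent (appended, lead c2) -/

/-- **Site/bond crossing universality + Cardy for bond-`ℤ²` ⟹ Cardy for site-`G_s`** (the converse transfer): apply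
`BondCardy` to the rotated rectangle `ρR'` (`ρ = (1−i)/√2`), compare with `siteProb (ρ⁻¹(ρR')) = siteProb R'`
(`frame_map_rot_map_rotInv`, exact) through the universality hypothesis, and pull the crossing limit back along the
rotation (`frame_hasCrossingLimit_of_map_similarity`). [cite: Beffara2008Universal, §1.2] -/
theorem siteCardy_of_bondCardy_of_universality
    (hU : ∀ R : ConformalRectangle, Tendsto (fun δ : ℝ =>
      siteProb (R.map (similarity ((1 + Complex.I) / (Real.sqrt 2 : ℂ)) frame_rotInv_ne_zero 0)) δ -
        bondProb R δ) (𝓝[>] 0) (𝓝 0))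
    (hB : BondCardy) : SiteCardy := by
  intro R'
  refine frame_hasCrossingLimit_of_map_similarity R' _ frame_rot_ne_zero 0 ?_
  intro ψ x hψ
  have hu := hU (R'.map (similarity ((1 - Complex.I) / (Real.sqrt 2 : ℂ)) frame_rot_ne_zero 0))
  rw [frame_map_rot_map_rotInv R'] at hu
  have h := (hB _ ψ x hψ).add hu
  rw [add_zero] at h
  refine h.congr' (Eventually.of_forall fun δ => ?_)
  simp only [add_sub_cancel]

/-- **Under site/bond crossing universality the two Cardy formulas are EQUIVALENT**: `SiteCardy ↔ BondCardy`
("→" is the crux `CoveringLeg`, `coveringLeg_of_crossingUniversality`; "←" is `siteCardy_of_bondCardy_of_universality`).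
Together with `siteBondCrossingUniversality_of_cardy` (both Cardy formulas ⟹ universality) this closes the circle:
universality ∧ (either Cardy) ⟺ (both Cardy). [cite: Beffara2008Universal, §1.2 and §5] -/
theorem siteCardy_iff_bondCardy_of_universality : (∀ R : Literature.Probability.RandomPlanarGeometry.ConformalRectangle, Filter.Tendsto (fun δ : ℝ => Summit.CriticalPhenomena.CardyFormulaZ2.Cruxes.CoveringLeg.FiveArmNull.siteProb (R.map (Literature.Probability.RandomPlanarGeometry.similarity ((1 + Complex.I) / (Real.sqrt 2 : ℂ)) Summit.CriticalPhenomena.CardyFormulaZ2.Cruxes.CoveringLeg.FiveArmNull.frame_rotInv_ne_zero 0)) δ - Summit.CriticalPhenomena.CardyFormulaZ2.Cruxes.CoveringLeg.FiveArmNull.bondProb R δ) (nhdsWithin 0 (Set.Ioi 0)) (nhds 0)) → (Summit.CriticalPhenomena.CardyFormulaZ2.Cruxes.CoveringLeg.FiveArmNull.SiteCardy ↔ Summit.CriticalPhenomena.CardyFormulaZ2.Cruxes.CoveringLeg.FiveArmNull.BondCardy) :=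
  fun hU => ⟨fun hS => coveringLeg_iff.1 (coveringLeg_of_crossingUniversality hU) hS,
    siteCardy_of_bondCardy_of_universality hU⟩

end Summit.CriticalPhenomena.CardyFormulaZ2.Cruxes.CoveringLeg.FiveArmNull

end
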